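import Summits.CriticalPhenomena.PercolationContinuityZ3.Theorems.PercNearOneGluingNoHeavyLowerTailIncStarTwoEdgeBernstein
import HarnessLib

/-!
# The root-edge Bernstein (hRZ) forms are themselves inductive: the step along a second pair costs exactly the four mixed two-edge fibres

Support file for the Sahi programme (`--supports stmt-CriticalPhenomena-4575`, prover prim-sahi-p2 gen 29).  No definitions, no named facts, no
sorries; standard axioms.  Memo `run/shared/lean/prim/prim-sahi/FROM-prim-sahi-p2-gen29-ROOT-FIBRE-DICHOTOMY.md` §4c, `prim-sahi-p2/PROOF-E3.md` §39.

Gen 5 (`IncStar.incStar_nonneg_of_rootUnmarkedBernsteinStrongIH`) reduced the increasing star to hRZ: nonnegativity of the two mixed Bernstein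
coefficients `polar₁(P_{w[e↦0]}, P_{w[e↦1]})`, `polar₁(P_{w[e↦1]}, P_{w[e↦0]})` of `E₃` along a root pair `e`.  These forms are NOT certifiable from
the pairwise percolation inequalities and the stars (gens 5, 13, 28; gen 29: they are the 'triple-port' root fibres, not even semantic consequences of
Harris + van den Berg–Kahn + stars of quotients).  But they are INDUCTIVE: expanding the polarised form along a SECOND pair `e₁` (weight `p`;
`EdgeInduction.polar₁_oneBond`) gives, with `P^{ab} = P_{w[e₁↦a][e₂↦b]}`,

  `polar₁(P_{w[e₂↦0]}, P_{w[e₂↦1]}) = (1−p)³·polar₁(P⁰⁰,P⁰¹) + p(1−p)²·RF₁₁/3 + p²(1−p)·RF₂₁/3 + p³·polar₁(P¹⁰,P¹¹)`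
  `polar₁(P_{w[e₂↦1]}, P_{w[e₂↦0]}) = (1−p)³·polar₁(P⁰¹,P⁰⁰) + p(1−p)²·RF₁₂/3 + p²(1−p)·RF₂₂/3 + p³·polar₁(P¹¹,P¹⁰)`

(`polar₁_twoBond_left/right`): the corner forms are the same hRZ forms for the weights `w[e₁↦0]`, `w[e₁↦1]` — ONE FRACTIONAL PAIR FEWER, i.e.
induction hypotheses of a JOINT induction on (star, hRZ) — and the middle terms are the mixed two-edge root fibres `twoEdgeRF11, RF21` resp.
`RF12, RF22` of `EdgeInduction.sahiE3_twoBond`.  **Schema** (`rootEdgeBernstein_of_twoEdgeFibres`): the two hRZ forms along `e₂` are nonnegative as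
soon as the four corner forms and the four mixed fibres of the pair `(e₁, e₂)` are.  So the increasing star on all finite weighted graphs follows from
the nonnegativity of the four mixed two-edge fibres alone (memo §4c: for a degree-two root all four are now CERTIFIED — `RF11` by Harris (tree:
`IncStar.twoEdgeRF11_nonneg_of_degTwoRoot`), `RF12, RF21` by exact Harris + vdBK + star certificates, `RF22` by an exact Harris + vdBK + hRZ-of-quotients
certificate; for a general root they are the width-three 'triple-port' fibres whose certification from the same rows plus hRZ of quotients is the
open question).  Everything here holds for arbitrary events `A, B, C`; nothing asserts the fibre inequalities.
-/

noncomputable section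

namespace Summit.CriticalPhenomena.PercolationContinuityZ3.Theorems

namespace EdgeInduction

open MeasureTheory Literature.Probability.Percolation Literature.Probability.LatticeModels
open scoped Classical

variable {n : ℕ}

/-- **The hRZ form `polar₁(P_{w[e₂↦0]}, P_{w[e₂↦1]})` along a second pair `e₁ ≠ e₂`** (weight `p = w e₁`): corner hRZ forms of `w[e₁↦0]`,
`w[e₁↦1]` plus the mixed fibres `RF11/3`, `RF21/3`. [this work] -/
theorem polar₁_twoBond_left (w : Sym2 (Fin n) → unitInterval) {e₁ e₂ : Sym2 (Fin n)} (hne : e₁ ≠ e₂)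
    (A B C : Set (BondConfig (Fin n))) :
    polar₁ (prodBernoulli (Function.update w e₂ 0)) (prodBernoulli (Function.update w e₂ 1)) A B C =
      (1 - (w e₁ : ℝ)) ^ 3 * polar₁ (pin₂ w e₁ e₂ 0 0) (pin₂ w e₁ e₂ 0 1) A B C
      + (w e₁ : ℝ) * (1 - (w e₁ : ℝ)) ^ 2 * (twoEdgeRF11 w e₁ e₂ A B C / 3)
      + (w e₁ : ℝ) ^ 2 * (1 - (w e₁ : ℝ)) * (twoEdgeRF21 w e₁ e₂ A B C / 3)
      + (w e₁ : ℝ) ^ 3 * polar₁ (pin₂ w e₁ e₂ 1 0) (pin₂ w e₁ e₂ 1 1) A B C := by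
  have hw : (Function.update w e₂ (1 : unitInterval)) e₁ = (Function.update w e₂ (0 : unitInterval)) e₁ := by
    rw [Function.update_of_ne hne, Function.update_of_ne hne]
  have h := polar₁_oneBond (Function.update w e₂ 0) (Function.update w e₂ 1) e₁ hw A B C
  rw [Function.update_of_ne hne] at h
  rw [h]
  simp only [pin₂, twoEdgeRF11, twoEdgeRF21, polar₁, trilin, Function.update_comm hne.symm]
  ring

/-- **The reverse hRZ form `polar₁(P_{w[e₂↦1]}, P_{w[e₂↦0]})` along `e₁ ≠ e₂`**: corner forms plus `RF12/3`, `RF22/3`. [this work] -/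
theorem polar₁_twoBond_right (w : Sym2 (Fin n) → unitInterval) {e₁ e₂ : Sym2 (Fin n)} (hne : e₁ ≠ e₂)
    (A B C : Set (BondConfig (Fin n))) :
    polar₁ (prodBernoulli (Function.update w e₂ 1)) (prodBernoulli (Function.update w e₂ 0)) A B C =
      (1 - (w e₁ : ℝ)) ^ 3 * polar₁ (pin₂ w e₁ e₂ 0 1) (pin₂ w e₁ e₂ 0 0) A B C
      + (w e₁ : ℝ) * (1 - (w e₁ : ℝ)) ^ 2 * (twoEdgeRF12 w e₁ e₂ A B C / 3)
      + (w e₁ : ℝ) ^ 2 * (1 - (w e₁ : ℝ)) * (twoEdgeRF22 w e₁ e₂ A B C / 3)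
      + (w e₁ : ℝ) ^ 3 * polar₁ (pin₂ w e₁ e₂ 1 1) (pin₂ w e₁ e₂ 1 0) A B C := by
  have hw : (Function.update w e₂ (0 : unitInterval)) e₁ = (Function.update w e₂ (1 : unitInterval)) e₁ := by
    rw [Function.update_of_ne hne, Function.update_of_ne hne]
  have h := polar₁_oneBond (Function.update w e₂ 1) (Function.update w e₂ 0) e₁ hw A B C
  rw [Function.update_of_ne hne] at h
  rw [h]
  simp only [pin₂, twoEdgeRF12, twoEdgeRF22, polar₁, trilin, Function.update_comm hne.symm]
  ring

/-- **hRZ IS INDUCTIVE (the two-edge step).**  Along a pair `e₂`, both root-edge Bernstein forms of `E₃(A,B,C)` are nonnegative as soon as, for a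
second pair `e₁ ≠ e₂`, the four corner forms of the weights `w[e₁↦0]`, `w[e₁↦1]` (one fractional pair fewer: induction hypotheses) and the four
mixed two-edge fibres `RF11, RF12, RF21, RF22` of `(e₁, e₂)` are nonnegative. [this work] -/
theorem rootEdgeBernstein_of_twoEdgeFibres (w : Sym2 (Fin n) → unitInterval) {e₁ e₂ : Sym2 (Fin n)} (hne : e₁ ≠ e₂)
    (A B C : Set (BondConfig (Fin n)))
    (h01 : 0 ≤ polar₁ (pin₂ w e₁ e₂ 0 0) (pin₂ w e₁ e₂ 0 1) A B C)
    (h02 : 0 ≤ polar₁ (pin₂ w e₁ e₂ 0 1) (pin₂ w e₁ e₂ 0 0) A B C)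
    (h31 : 0 ≤ polar₁ (pin₂ w e₁ e₂ 1 0) (pin₂ w e₁ e₂ 1 1) A B C)
    (h32 : 0 ≤ polar₁ (pin₂ w e₁ e₂ 1 1) (pin₂ w e₁ e₂ 1 0) A B C)
    (h11 : 0 ≤ twoEdgeRF11 w e₁ e₂ A B C) (h12 : 0 ≤ twoEdgeRF12 w e₁ e₂ A B C)
    (h21 : 0 ≤ twoEdgeRF21 w e₁ e₂ A B C) (h22 : 0 ≤ twoEdgeRF22 w e₁ e₂ A B C) :
    0 ≤ polar₁ (prodBernoulli (Function.update w e₂ 0)) (prodBernoulli (Function.update w e₂ 1)) A B C ∧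
      0 ≤ polar₁ (prodBernoulli (Function.update w e₂ 1)) (prodBernoulli (Function.update w e₂ 0)) A B C := by
  have hp0 : (0 : ℝ) ≤ w e₁ := (w e₁).2.1
  have hp1 : (0 : ℝ) ≤ 1 - (w e₁ : ℝ) := sub_nonneg.2 (w e₁).2.2
  constructor
  · rw [polar₁_twoBond_left w hne A B C]
    generalize (w e₁ : ℝ) = p at hp0 hp1 ⊢
    generalize polar₁ (pin₂ w e₁ e₂ 0 0) (pin₂ w e₁ e₂ 0 1) A B C = x01 at h01 ⊢
    generalize polar₁ (pin₂ w e₁ e₂ 1 0) (pin₂ w e₁ e₂ 1 1) A B C = x31 at h31 ⊢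
    generalize twoEdgeRF11 w e₁ e₂ A B C = x11 at h11 ⊢
    generalize twoEdgeRF21 w e₁ e₂ A B C = x21 at h21 ⊢
    positivity
  · rw [polar₁_twoBond_right w hne A B C]
    generalize (w e₁ : ℝ) = p at hp0 hp1 ⊢
    generalize polar₁ (pin₂ w e₁ e₂ 0 1) (pin₂ w e₁ e₂ 0 0) A B C = x02 at h02 ⊢
    generalize polar₁ (pin₂ w e₁ e₂ 1 1) (pin₂ w e₁ e₂ 1 0) A B C = x32 at h32 ⊢
    generalize twoEdgeRF12 w e₁ e₂ A B C = x12 at h12 ⊢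
    generalize twoEdgeRF22 w e₁ e₂ A B C = x22 at h22 ⊢
    positivity

end EdgeInduction

end Summit.CriticalPhenomena.PercolationContinuityZ3.Theorems

end
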